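import Summits.Langlands.Langlands.Theses.HeptagonalTower
import Summits.Langlands.Langlands.Theorems.SectorComplement.Negative.RepeatedRootSocleVacuity

/-!
# Which `SectorComplement` does the `restated` stamp's theorem speak about?

Route `route-Langlands-HeptagonalTower` carries (ledger, 2026-08-17T12:41:52Z)
`restated = {kind: proved-equivalent, crux: stmt-Langlands-2175, decl: SectorComplement,
theorem: Summit.Langlands.Langlands.Theorems.SectorComplement.Negative.sectorComplement_iff_langlands,
direction: iff, reason: "(i) unconditional with no siblings"}`.

That theorem lives in `Theorems/SectorComplement/Negative/RepeatedRootSocleVacuity.lean`, which imports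
ONLY `Theses.RepeatedRootSocle`; its statement is about `RepeatedRootSocle.SectorComplement`
(`UnrefinedWeightTwoLifting → Langlands`, a VACUOUS sector), not about
`HeptagonalTower.SectorComplement` (`Target → Langlands`, Target = modularity of elliptic curves over the
real 7-cyclotomic tower).  The `example` below elaborates (rc 0 expected): the cited constant has type
`RepeatedRootSocle.SectorComplement ↔ Langlands`.  The companion file `RestatedStamp_negative.lean`
shows the HeptagonalTower reading does NOT follow from it (type mismatch) nor by automation.
-/

-- the cited theorem, fully qualified, is about the RepeatedRootSocle frame:
example : Summit.Langlands.Langlands.Theses.RepeatedRootSocle.SectorComplement ↔ Langlands :=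
  Summit.Langlands.Langlands.Theorems.SectorComplement.Negative.sectorComplement_iff_langlands

-- and the two homonymous decls are different propositions with different antecedents:
example : Summit.Langlands.Langlands.Theses.RepeatedRootSocle.SectorComplement =
    (Summit.Langlands.Langlands.Theses.RepeatedRootSocle.UnrefinedWeightTwoLifting → Langlands) := rfl

example : Summit.Langlands.Langlands.Theses.HeptagonalTower.SectorComplement =
    (Summit.Langlands.Langlands.Theses.HeptagonalTower.Target → Langlands) := rfl

#check @Summit.Langlands.Langlands.Theorems.SectorComplement.Negative.sectorComplement_iff_langlands
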